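/-
Origin: expansion seat `planner-pub-hodgecm-pv12-0`, handover 2026-08-18T04:04:55Z (`HOME/pub-hodgecm-pv12/lean/Pv12/FockAddenda.lean`, md5 287b7173, 96 lines);
landed by the gen-5 packager in gate run 21 as `HodgeCM/PerL34/FockAddenda.lean` (verbatim).
-/
/-
# pub-hodgecm · pv12 · addenda to the Fock layer (D5) — `det(z)` is the wedge of the two lines; transport of `gen`

Node(s): support for N28 → N29 (`ArchCDatum.gen`) and for N19-gen ("generators are wedges", PerL v5 ll. 363–365).
Imports the LANDED `HodgeCM.PerL34.FockKTypes` and `HodgeCM.PerL34.ArchBGen` (gate run 20) and adds, with nothing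
asserted:

* D. the two-line model at `ι₁` as the tensor product of the one-line models — `lineEmb j : HarmModel →ₐ[ℂ] PlaneModel`
  (`z_a ↦ z_{a j}`, `w ↦ w_j`), `pairMap : HarmModel ⊗[ℂ] HarmModel →ₐ[ℂ] PlaneModel` (multiplication), the harmonic
  wedge `harmWedge := z₁ ⊗ z₂ − z₂ ⊗ z₁`, and `pairMap_harmWedge : pairMap harmWedge = det(z)`; hence
  `isKappaVector_iff_wedge`: the `κ`-vectors of the two-line model are exactly the multiples of the image of the wedge
  of the lowest harmonics of the two lines (PerL ll. 363–365: "`∧²V⁺ ⊗ ∧²W = det_{V⁺} ⊗ det_W`, generated by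
  `det(z)`" — the local shadow at `ι₁` of N19's "every generator is a combination of wedges `u₁ ∧ u₂`");
* E. `isGeneratedBy_of_equiv`: transport of the `gen` format (`HodgeCM.PerL34.Fock.IsGeneratedBy`, = the field
  `ArchCDatum.gen` of `HodgeCM/PerL34/ArchC.lean`) along an equivariant linear isomorphism — so that instantiating
  `ArchCDatum.gen` from the intended local model needs only the Dictionary in the form "the intended `𝓕^κ_b` is
  isomorphic to `kappaPart_b` compatibly with `𝔲(W_b)_ℂ` and `φ⁰_b`" plus `isGeneratedBy_E/M/I`, `isGeneratedBy_tmul`.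

PRINT / Dictionary residual: unchanged (see the module docstrings of `ArchB`, `FockKTypes`; [BW VIII §2], [Adams 2007
Def 2.7, §4, Prop 6.6, Thm 6.3 — the latter now typed verbatim as `HodgeCM.Literature.CompactDualPairFock.Adams_Thm_6_3`
by cf-matsushima-murakami]).
-/
import Summits.HodgeConjecture.HodgeCM.PerL34.FockKTypes
import Summits.HodgeConjecture.HodgeCM.PerL34.ArchBGen
import Mathlib.RingTheory.TensorProduct.Maps

set_option autoImplicit false

namespace HodgeCM.PerL34.Fock

open MvPolynomial
open scoped TensorProduct

/-! ## D. The two-line model as the tensor product of the one-line models: `det(z) = z₁ ⊗ z₂ − z₂ ⊗ z₁` -/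

section Wedge

/-- Line `j` inside the two-line model: `z_a ↦ z_{a j}`, `w ↦ w_j`. -/
noncomputable def lineEmb (j : Fin 2) : HarmModel →ₐ[ℂ] PlaneModel :=
  aeval (Sum.elim (fun a => z a j) fun _ => w j)

/-- (Ported verbatim from the HodgeCMPerL package; no docstring in the source.) -/
@[simp] theorem lineEmb_hz (j a : Fin 2) : lineEmb j (hz a) = z a j := by
  simp [lineEmb, hz]

/-- (Ported verbatim from the HodgeCMPerL package; no docstring in the source.) -/
@[simp] theorem lineEmb_hw (j : Fin 2) : lineEmb j hw = w j := by
  simp [lineEmb, hw]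

/-- `𝓕_{ι₁}(W₁ ⊕ W₂) = 𝓕_{ι₁}(W₁) ⊗ 𝓕_{ι₁}(W₂)`: the multiplication map `φ ⊗ ψ ↦ φ(z_{·0}, w_0)·ψ(z_{·1}, w_1)`. -/
noncomputable def pairMap : HarmModel ⊗[ℂ] HarmModel →ₐ[ℂ] PlaneModel :=
  Algebra.TensorProduct.productMap (lineEmb 0) (lineEmb 1)

/-- (Ported verbatim from the HodgeCMPerL package; no docstring in the source.) -/
theorem pairMap_tmul (φ ψ : HarmModel) : pairMap (φ ⊗ₜ[ℂ] ψ) = lineEmb 0 φ * lineEmb 1 ψ :=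
  Algebra.TensorProduct.productMap_apply_tmul _ _ φ ψ

/-- The wedge of the two lowest harmonics: `z₁ ⊗ z₂ − z₂ ⊗ z₁ ∈ ∧²(𝔭₊-harmonics)`. -/
noncomputable def harmWedge : HarmModel ⊗[ℂ] HarmModel := hz 0 ⊗ₜ[ℂ] hz 1 - hz 1 ⊗ₜ[ℂ] hz 0

/-- **`det(z)` is the wedge of the harmonics of the two lines** (PerL ll. 363–365: "the `(1,1)`-weight space spanned
by `z_{1j}z_{2j'}` inside `Sym²(V⁺⊗W) = Sym²V⁺⊗Sym²W ⊕ ∧²V⁺⊗∧²W` … `∧²V⁺ ⊗ ∧²W = det_{V⁺} ⊗ det_W`, generated by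
`det(z)`" — the local shadow at `ι₁` of "generators of `S₁₂` are wedges `u₁ ∧ u₂`", node N19). -/
theorem pairMap_harmWedge : pairMap harmWedge = detZ := by
  rw [harmWedge, map_sub, pairMap_tmul, pairMap_tmul, lineEmb_hz, lineEmb_hz, lineEmb_hz, lineEmb_hz, detZ]
  ring

/-- Hence the `κ`-vectors of the two-line model are exactly the multiples of the image of the harmonic wedge. -/
theorem isKappaVector_iff_wedge (f : PlaneModel) : IsKappaVector f ↔ ∃ a : ℂ, f = a • pairMap harmWedge := by
  rw [pairMap_harmWedge]
  exact isKappaVector_iff f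

end Wedge

/-! ## E. Transport of the `gen` format along an equivariant isomorphism -/

section Transport

/-- Transport along an equivariant linear isomorphism (for the instantiation of `ArchCDatum` from the intended
model: it suffices that the intended `𝓕^κ_b` be isomorphic to `kappaPart_b` compatibly with the operators and
`φ⁰_b` — the Dictionary — to inherit `gen`). -/
theorem isGeneratedBy_of_equiv {F F' : Type*} [AddCommGroup F] [Module ℂ F] [AddCommGroup F'] [Module ℂ F']
    {ι : Type*} {X : ι → F →ₗ[ℂ] F} {X' : ι → F' →ₗ[ℂ] F'} (e : F ≃ₗ[ℂ] F')
    (hX : ∀ (k : ι) (φ : F), e (X k φ) = X' k (e φ)) {φ₀ : F} (h : IsGeneratedBy X' (e φ₀)) :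
    IsGeneratedBy X φ₀ := by
  intro S h0 hS
  have htop := h (S.map (e : F →ₗ[ℂ] F')) ⟨φ₀, h0, rfl⟩ (by
    rintro k _ ⟨φ, hφ, rfl⟩
    exact ⟨X k φ, hS k φ hφ, hX k φ⟩)
  rw [eq_top_iff]
  rintro x -
  have hx : e x ∈ S.map (e : F →ₗ[ℂ] F') := by rw [htop]; exact Submodule.mem_top
  obtain ⟨y, hy, hyx⟩ := hx
  have : y = x := e.injective hyx
  rwa [this] at hy

end Transport

end HodgeCM.PerL34.Fock
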